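import Summits.ResolutionOfSingularities.ResolutionOfSingularities.Theorems.WeightedInvariantContactCentreFiltration
import Summits.ResolutionOfSingularities.ResolutionOfSingularities.Theorems.WeightedInvariantContactFiltrationTerminal
import Summits.ResolutionOfSingularities.ResolutionOfSingularities.Theorems.WeightedInvariantContactFiltrationUnboundedLevel
import Summits.ResolutionOfSingularities.ResolutionOfSingularities.Theorems.WeightedInvariantHypersurfaceLocalGameEFTCurveMoveDrop
import Summits.ResolutionOfSingularities.ResolutionOfSingularities.Theorems.WeightedInvariantHypersurfaceLocalGameEFTDimTwoSteepening
import HarnessLib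

/-!
# The P2 rung of `LocalWeightedDropEFT4S` for `(iotaOrd, jContact)`, game clause I: terminal level and monomial type

Topic: `Summits/ResolutionOfSingularities/ResolutionOfSingularities/Theorems`. Helper for the door item
`HypersurfaceCentreConstruction` (statement `stmt-ResolutionOfSingularities-19897`, route `WeightedInvariant`);
ORDER (o24-G) of `res-L1-w43-plan-1` (2026-08-27T08:16:45Z): the conjunct `CanonicalGameClauseLE2 p iotaOrd jContact` of
the P2 rung `P2Rung` (`…EFT4SDimLETwo`, p512950), part 1 of 2 — the two pieces of glue between the (o13) dim-2 game
(K7, `…EFTDimTwo`, p514254/p515237) and the (o24-D) centre filtration `jContact` (`…ContactCentreFiltration`, p514802).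

[OURS · L1 W4.3] Replaces the role of NO printed item; NOT a statement of the manuscript
[claim: Hironaka2017, status: under-review]. AI work, weaker than expert review.

## Content (namespace `LocalGameEFTDimTwoGame`)

* MONOMIAL TYPE (`f = v·g^ν`, case A): `weightedMonomialIdeal_vecCons_zero_one` — the move `u = (x, g)`, `w = (0, 1)`
  presents `(g)^m`; `exists_span_pair_of_not_mem_sq` — a regular parameter `g` of a two-dimensional regular local
  ring is a member of a regular system `(x, g)`; **`isUnit_transform_of_monomialType`** — in the chart
  `B = S[t⁻¹, (gⁿ)tⁿ]` every saturated transform of `v·g^ν` is a UNIT off the vertex (K2 `LocalGameEFTCurveMove.transform_eq`),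
  so the successor conjunct of the game clause is VACUOUS in case A.
* TERMINAL LEVEL (case B of (o24-G), `f` not of monomial type): from the CERTIFICATE of the terminal system `(x, y_T, b_T)`
  of `LocalGameEFTDimTwo.exists_terminal_of_not_associated_pow` — (B) `b_T = 1` and prepared at level `1` in NO regular
  system / (C) prepared at `b_T`, `𝒥_{b_T+1}((b_T+1)ν)` not reached / (D) `b_T ≥ 2`, reached, not steepenable —
  **`mem_contactFiltration_of_terminal`** (`y_T` carries `f` to level `b_T`: 078's C1) and
  **`not_mem_contactFiltration_succ_of_terminal`** (NO `g ∈ 𝔪 ∖ 𝔪²` carries `f` to level `b_T + 1`: 078's C5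
  `not_mem_succ_of_caseC` / `not_mem_succ_of_caseD` for (C)/(D) — the case-(D) hypotheses of C5 being produced from
  the ring-side certificate by K5b `exists_face` + K5d `exists_steepen_of_face_eq_pow` — and, for (B), the inclusion
  `F_{g,2}(2ν) ⊆ (g^ν) + 𝔪^{ν+1}`), whence **`bMax_eq_of_terminal`**: `bMax f = b_T` (the `sSup` is attained at `b_T`).

## References

* H. Hironaka, *Characteristic polyhedra of singularities*, J. Math. Kyoto Univ. 7 (1967) 251–293. [Hironaka1967]
* V. Cossart, U. Jannsen, S. Saito, *Desingularization: invariants and strategy*, LNM 2270 (2020), Ch. 8. [CossartJannsenSaito2020]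
-/

noncomputable section

open IsLocalRing Literature.AlgebraicGeometry.Resolution
open Summit.ResolutionOfSingularities.ResolutionOfSingularities.Cruxes.HypersurfaceCentreConstruction.LocalEngine
  (contactFiltration contactFiltration_def Reaches bMax bMax_def)

set_option linter.dupNamespace false -- mandated namespace of this single-conjunct summit

namespace Summit.ResolutionOfSingularities.ResolutionOfSingularities.Theorems

namespace LocalGameEFTDimTwoGame

variable {S : Type} [CommRing S]

/-! ### Monomial type: the move `(x, g), (0, 1)` -/

/-- `![0, 1] = Pi.single 1 1` as weights `Fin 2 → ℕ`. [folklore] -/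
theorem vecCons_zero_one_eq_single : (![0, 1] : Fin 2 → ℕ) = Pi.single (1 : Fin 2) 1 := by
  ext i; fin_cases i <;> simp

/-- The move `u = (x, g)`, `w = (0, 1)` has `𝒥ₘ = (g)^m`. [cite: Wlodarczyk2022, Lemma 2.1.12] -/
theorem weightedMonomialIdeal_vecCons_zero_one (x g : S) (m : ℕ) :
    weightedMonomialIdeal ![x, g] ![0, 1] m = Ideal.span {g} ^ m := by
  rw [vecCons_zero_one_eq_single, LocalGameEFTCurveMove.weightedMonomialIdeal_single_eq, Ideal.span_singleton_pow]
  rfl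

/-- In a regular local ring with `spanFinrank 𝔪 = 2`, a regular parameter `g ∈ 𝔪 ∖ 𝔪²` is the second member of a regular
system of parameters `(x, g)`. [cite: Matsumura1987, Thm. 14.2] -/
theorem exists_span_pair_of_not_mem_sq [IsRegularLocalRing S] (hd : (maximalIdeal S).spanFinrank = 2) {g : S}
    (hg : g ∈ maximalIdeal S) (hg2 : g ∉ maximalIdeal S ^ 2) : ∃ x : S, Ideal.span {x, g} = maximalIdeal S := by
  obtain ⟨k, v, hspan, hrank⟩ := LocalGameEFTCurveMove.exists_fin_cons_span_eq_maximalIdeal S hg hg2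
  have hk : k = 1 := by omega
  subst hk
  refine ⟨v 0, ?_⟩
  rw [← hspan, Fin.range_cons, Set.range_unique, Ideal.span_pair_comm]
  rfl

/-- **Case A has a VACUOUS successor clause.** In a regular local ring `S`, let `π ∈ 𝔪 ∖ 𝔪²`, `v` a unit, and
`B = S[t⁻¹, (πⁿ)tⁿ]` the algebra of the one-element chart `u = (π)`, `w = (1)` (equivalently of `(x, π), (0, 1)`). For every
prime `𝔫` of `B` off the vertex and every factorisation `v·π^ν = t⁻ᵃ g` with `t⁻¹ ∤ g`, the transform `g = v·(πt)^ν` is a UNIT of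
`B_𝔫` (K2 `LocalGameEFTCurveMove.transform_eq`, `piT_not_mem`). [OURS · L1 W4.3 · (o24-G)] -/
theorem isUnit_transform_of_monomialType [IsRegularLocalRing S] {π v : S} (hπ : π ∈ maximalIdeal S)
    (hπ2 : π ∉ maximalIdeal S ^ 2) (hv : IsUnit v) (ν : ℕ)
    (𝔫 : Ideal (extReesAlgebra (weightedMonomialIdeal (fun _ : Fin 1 => π) (fun _ => 1)))) [𝔫.IsPrime]
    (hV : ¬ extReesAlgebra.vertexIdeal (weightedMonomialIdeal (fun _ : Fin 1 => π) (fun _ => 1)) ≤ 𝔫)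
    {a : ℕ} {g : extReesAlgebra (weightedMonomialIdeal (fun _ : Fin 1 => π) (fun _ => 1))}
    (hfg : algebraMap S _ (v * π ^ ν) = extReesAlgebra.tInv (weightedMonomialIdeal (fun _ : Fin 1 => π) (fun _ => 1)) ^ a * g)
    (hndvd : ¬ extReesAlgebra.tInv (weightedMonomialIdeal (fun _ : Fin 1 => π) (fun _ => 1)) ∣ g) :
    IsUnit (algebraMap _ (Localization.AtPrime 𝔫) g) := by
  haveI := isDomain_of_isRegularLocalRing S
  have hprime : Prime π := IsRegularLocalRing.prime_of_not_mem_sq hπ hπ2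
  have hv' : ¬ π ∣ v := fun h => by
    obtain ⟨c, rfl⟩ := h
    exact (mem_nonunits_iff.mp ((mem_maximalIdeal _).mp (Ideal.mul_mem_right c _ hπ))) hv
  rw [mul_comm] at hfg
  obtain ⟨-, rfl⟩ := LocalGameEFTCurveMove.transform_eq hprime hv' hfg hndvd
  rw [map_mul, map_pow]
  refine IsUnit.mul (IsUnit.pow _ ?_) ((hv.map _).map _)
  exact IsLocalization.map_units (Localization.AtPrime 𝔫)
    (⟨LocalGameEFTCurveMove.piT π, LocalGameEFTCurveMove.piT_not_mem π hV⟩ : 𝔫.primeCompl)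

/-- `isUnit_transform_of_monomialType` transported to any filtration `I` EQUAL to the one-element chart's (e.g.
`I = weightedMonomialIdeal ![x, π] ![0, 1]`, by `weightedMonomialIdeal_vecCons_zero_one`-type rewriting), so that a
consumer whose algebra is typed as `extReesAlgebra I` need not rewrite inside binder types. [OURS · L1 W4.3 · (o24-G)] -/
theorem isUnit_transform_of_monomialType' [IsRegularLocalRing S] {π v : S} (hπ : π ∈ maximalIdeal S)
    (hπ2 : π ∉ maximalIdeal S ^ 2) (hv : IsUnit v) (ν : ℕ) {I : ℕ → Ideal S}
    (hI : I = weightedMonomialIdeal (fun _ : Fin 1 => π) (fun _ => 1))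
    (𝔫 : Ideal (extReesAlgebra I)) [𝔫.IsPrime] (hV : ¬ extReesAlgebra.vertexIdeal I ≤ 𝔫)
    {a : ℕ} {g : extReesAlgebra I} (hfg : algebraMap S _ (v * π ^ ν) = extReesAlgebra.tInv I ^ a * g)
    (hndvd : ¬ extReesAlgebra.tInv I ∣ g) :
    IsUnit (algebraMap _ (Localization.AtPrime 𝔫) g) := by
  subst hI
  exact isUnit_transform_of_monomialType hπ hπ2 hv ν 𝔫 hV hfg hndvd

/-- The filtration of the move `(x, g), (0, 1)` IS the one-element chart's `n ↦ (gⁿ)`. [folklore] -/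
theorem weightedMonomialIdeal_vecCons_zero_one_eq_one (x g : S) :
    weightedMonomialIdeal ![x, g] ![0, 1] = weightedMonomialIdeal (fun _ : Fin 1 => g) (fun _ => 1) := by
  rw [vecCons_zero_one_eq_single, LocalGameEFTCurveMove.weightedMonomialIdeal_single_eq_one]
  rfl

/-! ### The terminal certificate reaches the terminal level and no further -/

/-- `𝒥_b(bν+1) ⊆ 𝔪^{ν+1}` for the weights `(1, b)`, `b ≥ 1`, when `x, y ∈ 𝔪`. [folklore] -/
theorem weightedMonomialIdeal_succ_le_pow [IsLocalRing S] {x y : S} (hx : x ∈ maximalIdeal S) (hy : y ∈ maximalIdeal S)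
    {b : ℕ} (hb : 1 ≤ b) (ν : ℕ) :
    weightedMonomialIdeal ![x, y] ![1, b] (b * ν + 1) ≤ maximalIdeal S ^ (ν + 1) := by
  rw [weightedMonomialIdeal, Ideal.span_le]
  rintro _ ⟨α, hα, rfl⟩
  simp only [Fin.sum_univ_two, Matrix.cons_val_zero, Matrix.cons_val_one, one_mul] at hα
  rw [Fin.prod_univ_two]
  simp only [Matrix.cons_val_zero, Matrix.cons_val_one, SetLike.mem_coe]
  have hdeg : ν + 1 ≤ α 0 + α 1 := by
    rcases le_or_gt (α 1) ν with hj | hj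
    · have e1 : b * ν = b * (ν - α 1) + b * α 1 := by rw [← Nat.mul_add, Nat.sub_add_cancel hj]
      have e2 : 1 * (ν - α 1) ≤ b * (ν - α 1) := Nat.mul_le_mul_right _ hb
      omega
    · omega
  refine Ideal.pow_le_pow_right hdeg ?_
  rw [pow_add]
  exact Ideal.mul_mem_mul (Ideal.pow_mem_pow hx _) (Ideal.pow_mem_pow hy _)

section Terminal

variable [IsRegularLocalRing S] (hd : (maximalIdeal S).spanFinrank = 2) {x y : S}
  (hxy : Ideal.span {x, y} = maximalIdeal S) {f : S} {ν : ℕ} (hν1 : 1 ≤ ν)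
  (hfν : f ∈ maximalIdeal S ^ ν) (hfν' : f ∉ maximalIdeal S ^ (ν + 1)) {b : ℕ} (hb : 1 ≤ b)

include hxy hfν' in
/-- At a level `b ≥ 2` reached in `(x, y)`, the top coefficient of ANY level-`b` face of `f` is a unit (the other face
monomials `x^{b(ν-j)} y^j`, `j < ν`, lie in `𝔪^{ν+1}`, as does `𝒥_b(bν+1)`; `f ∉ 𝔪^{ν+1}`). [folklore] -/
theorem isUnit_face_top (hb2 : 2 ≤ b) {a : ℕ → S}
    (hface : f - ∑ j ∈ Finset.range (ν + 1), a j * (x ^ (b * (ν - j)) * y ^ j) ∈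
      weightedMonomialIdeal ![x, y] ![1, b] (b * ν + 1)) : IsUnit (a ν) := by
  have hx : x ∈ maximalIdeal S := hxy ▸ Ideal.subset_span (by simp)
  have hy : y ∈ maximalIdeal S := hxy ▸ Ideal.subset_span (by simp)
  by_contra hnu
  have haν : a ν ∈ maximalIdeal S := (mem_maximalIdeal _).mpr (mem_nonunits_iff.mpr hnu)
  apply hfν'
  have hlow : ∑ j ∈ Finset.range ν, a j * (x ^ (b * (ν - j)) * y ^ j) ∈ maximalIdeal S ^ (ν + 1) := by
    refine Ideal.sum_mem _ fun j hj => Ideal.mul_mem_left _ _ ?_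
    have hj' : j < ν := Finset.mem_range.mp hj
    have hdeg : ν + 1 ≤ b * (ν - j) + j := by
      have e2 : 2 * (ν - j) ≤ b * (ν - j) := Nat.mul_le_mul_right _ hb2
      omega
    refine Ideal.pow_le_pow_right hdeg ?_
    rw [pow_add]
    exact Ideal.mul_mem_mul (Ideal.pow_mem_pow hx _) (Ideal.pow_mem_pow hy _)
  have htop : a ν * (x ^ (b * (ν - ν)) * y ^ ν) ∈ maximalIdeal S ^ (ν + 1) := by
    rw [Nat.sub_self, mul_zero, pow_zero, one_mul, pow_succ']
    exact Ideal.mul_mem_mul haν (Ideal.pow_mem_pow hy ν)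
  have hsum : ∑ j ∈ Finset.range (ν + 1), a j * (x ^ (b * (ν - j)) * y ^ j) ∈ maximalIdeal S ^ (ν + 1) := by
    rw [Finset.sum_range_succ]
    exact Ideal.add_mem _ hlow htop
  have := Ideal.add_mem _ (weightedMonomialIdeal_succ_le_pow hx hy (by omega) ν hface) hsum
  rwa [sub_add_cancel] at this

include hxy hfν hb in
/-- **The terminal system reaches its level**: under certificate (B), (C) or (D) of
`LocalGameEFTDimTwo.exists_terminal_of_not_associated_pow`, `y_T` carries `f` to level `b_T`:
`f ∈ contactFiltration y_T b_T (b_T ν)` (078's C1 `weightedMonomialIdeal_eq_contactFiltration`; for (B), `𝔪^ν`).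
[OURS · L1 W4.3 · (o24-G)] -/
theorem mem_contactFiltration_of_terminal
    (hcert : (b = 1 ∧ ¬ ∃ x' y' c : S, Ideal.span {x', y'} = maximalIdeal S ∧ IsUnit c ∧
        f - c * y' ^ ν ∈ weightedMonomialIdeal ![x', y'] ![1, 1] (1 * ν + 1)) ∨
      ((∃ c : S, IsUnit c ∧ f - c * y ^ ν ∈ weightedMonomialIdeal ![x, y] ![1, b] (b * ν + 1)) ∧
        f ∉ weightedMonomialIdeal ![x, y] ![1, b + 1] ((b + 1) * ν)) ∨
      (2 ≤ b ∧ f ∈ weightedMonomialIdeal ![x, y] ![1, b] (b * ν) ∧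
        ¬ ∃ c lam : S, IsUnit c ∧
          f - c * (y - lam * x ^ b) ^ ν ∈ weightedMonomialIdeal ![x, y] ![1, b] (b * ν + 1))) :
    f ∈ contactFiltration y b (b * ν) := by
  have hfJ : f ∈ weightedMonomialIdeal ![x, y] ![1, b] (b * ν) := by
    rcases hcert with ⟨rfl, -⟩ | ⟨⟨c, -, hprep⟩, -⟩ | ⟨-, hfJ, -⟩
    · rw [LocalGameEFTSteepening.weightedMonomialIdeal_one_eq_pow, hxy, one_mul]; exact hfν
    · exact LocalGameEFTSteepening.mem_of_sub_mul_pow_mem hprep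
    · exact hfJ
  rwa [ContactFiltration.weightedMonomialIdeal_eq_contactFiltration hxy hb] at hfJ

include hd hxy hν1 hfν' hb in
/-- **The terminal system reaches no further**: under certificate (B), (C) or (D), NO regular parameter
`g ∈ 𝔪 ∖ 𝔪²` carries `f` to level `b_T + 1` (078's C5 `not_mem_succ_of_caseC` / `not_mem_succ_of_caseD`; for (B):
`F_{g,2}(2ν) ⊆ (g^ν) + 𝔪^{ν+1}` would prepare `f` at level `1` in a regular system `(x', g)`).
[OURS · L1 W4.3 · (o24-G)] [cite: Hironaka1967, Thm. (well-preparedness)] -/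
theorem not_mem_contactFiltration_succ_of_terminal
    (hcert : (b = 1 ∧ ¬ ∃ x' y' c : S, Ideal.span {x', y'} = maximalIdeal S ∧ IsUnit c ∧
        f - c * y' ^ ν ∈ weightedMonomialIdeal ![x', y'] ![1, 1] (1 * ν + 1)) ∨
      ((∃ c : S, IsUnit c ∧ f - c * y ^ ν ∈ weightedMonomialIdeal ![x, y] ![1, b] (b * ν + 1)) ∧
        f ∉ weightedMonomialIdeal ![x, y] ![1, b + 1] ((b + 1) * ν)) ∨
      (2 ≤ b ∧ f ∈ weightedMonomialIdeal ![x, y] ![1, b] (b * ν) ∧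
        ¬ ∃ c lam : S, IsUnit c ∧
          f - c * (y - lam * x ^ b) ^ ν ∈ weightedMonomialIdeal ![x, y] ![1, b] (b * ν + 1)))
    {g : S} (hg : g ∈ maximalIdeal S) (hg2 : g ∉ maximalIdeal S ^ 2) :
    f ∉ contactFiltration g (b + 1) ((b + 1) * ν) := by
  classical
  have hdimS : ringKrullDim S = (2 : ℕ) := by
    rw [← IsRegularLocalRing.spanFinrank_maximalIdeal, hd]
  rw [contactFiltration_def]
  rcases hcert with ⟨rfl, hnp⟩ | ⟨⟨c, hc, hprep⟩, hnext⟩ | ⟨hb2, hfJ, hst⟩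
  · -- (B): level `2` for `g` would prepare `f` at level `1` in `(x', g)`
    intro hmem
    have hmem2 : f ∈ ⨆ j, Ideal.span {g ^ j} * maximalIdeal S ^ (2 * ν - 2 * j) := by
      simpa only [show (1 : ℕ) + 1 = 2 from rfl] using hmem
    have hmem' := ContactFiltration.contactFiltration_le_span_pow_sup_pow hg (le_refl 2) ν hmem2
    obtain ⟨a, r, hr, hfar⟩ := Ideal.mem_span_singleton_sup.mp hmem'
    obtain ⟨x', hx'g⟩ := exists_span_pair_of_not_mem_sq hd hg hg2
    have ha : IsUnit a := by
      by_contra hnu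
      have ha' : a ∈ maximalIdeal S := (mem_maximalIdeal _).mpr (mem_nonunits_iff.mpr hnu)
      apply hfν'
      rw [← hfar]
      refine Ideal.add_mem _ ?_ hr
      rw [pow_succ']
      exact Ideal.mul_mem_mul ha' (Ideal.pow_mem_pow hg ν)
    refine hnp ⟨x', g, a, hx'g, ha, LocalGameEFTSteepening.sub_mem_weightedMonomialIdeal_one_of_sub_mem_pow hx'g ?_⟩
    rw [← hfar, add_sub_cancel_left]
    exact hr
  · -- (C): 078's C5
    exact ContactFiltration.not_mem_succ_of_caseC hdimS hxy hb hν1 hc hfν' hprep hnext hg hg2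
  · -- (D): produce C5's face hypotheses from the ring-side certificate
    obtain ⟨a, hface⟩ := LocalGameEFTSteepening.exists_face (x := x) (y := y) hb hfJ
    have haν : IsUnit (a ν) := isUnit_face_top hxy hfν' hb2 hface
    refine ContactFiltration.not_mem_succ_of_caseD hdimS hxy hb hν1 hfν' haν hface ?_ hg hg2
    intro cbar lbar
    by_contra hall
    push Not at hall
    have hcbar : cbar ≠ 0 := by
      have h := hall ν (Finset.self_mem_range_succ ν)
      rw [Nat.choose_self, Nat.cast_one, mul_one, Nat.sub_self, pow_zero, mul_one] at h
      rw [← h]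
      exact (residue_ne_zero_iff_isUnit _).mpr haν
    obtain ⟨c, lam, hc, -, -, hsteep⟩ :=
      LocalGameEFTSteepening.exists_steepen_of_face_eq_pow hxy hb hface hcbar hall
    exact hst ⟨c, lam, hc, hsteep⟩

include hd hxy hν1 hfν hfν' hb in
/-- **The terminal level IS `bMax`**: under certificate (B), (C) or (D), `bMax f = b_T` (the set of reached levels
`{b' ≥ 1 | Reaches f ν b'}` has greatest element `b_T`: `b_T` is reached through `y_T`, and a reached `b' > b_T` would
reach `b_T + 1` by downward closure, 078's `level_antitone`). [OURS · L1 W4.3 · (o24-G)] -/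
theorem bMax_eq_of_terminal
    (hcert : (b = 1 ∧ ¬ ∃ x' y' c : S, Ideal.span {x', y'} = maximalIdeal S ∧ IsUnit c ∧
        f - c * y' ^ ν ∈ weightedMonomialIdeal ![x', y'] ![1, 1] (1 * ν + 1)) ∨
      ((∃ c : S, IsUnit c ∧ f - c * y ^ ν ∈ weightedMonomialIdeal ![x, y] ![1, b] (b * ν + 1)) ∧
        f ∉ weightedMonomialIdeal ![x, y] ![1, b + 1] ((b + 1) * ν)) ∨
      (2 ≤ b ∧ f ∈ weightedMonomialIdeal ![x, y] ![1, b] (b * ν) ∧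
        ¬ ∃ c lam : S, IsUnit c ∧
          f - c * (y - lam * x ^ b) ^ ν ∈ weightedMonomialIdeal ![x, y] ![1, b] (b * ν + 1))) :
    bMax f = b := by
  have hy : y ∈ maximalIdeal S := hxy ▸ Ideal.subset_span (by simp)
  have hdimS : ringKrullDim S = (2 : ℕ) := by
    rw [← IsRegularLocalRing.spanFinrank_maximalIdeal, hd]
  have hy2 : y ∉ maximalIdeal S ^ 2 := (LocalGameEFTSteepening.not_mem_sq_of_span_pair_eq hdimS hxy).2
  -- `(adicOrder f).toNat = ν`
  have hord : (adicOrder f).toNat = ν := by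
    have h1 : (ν : ℕ∞) ≤ adicOrder f := (le_adicOrder_iff f ν).mpr hfν
    have h2 : adicOrder f ≤ ν := (adicOrder_le_iff f ν).mpr hfν'
    rw [le_antisymm h2 h1, ENat.toNat_coe]
  rw [bMax_def, hord]
  refine IsGreatest.csSup_eq ⟨⟨hb, y, hy, hy2, mem_contactFiltration_of_terminal hxy hfν hb hcert⟩, ?_⟩
  rintro b' ⟨-, g, hg, hg2, hreach⟩
  by_contra hlt
  push Not at hlt
  refine not_mem_contactFiltration_succ_of_terminal hd hxy hν1 hfν' hb hcert hg hg2 ?_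
  rw [contactFiltration_def] at hreach ⊢
  exact ContactFiltration.level_antitone g (Nat.succ_le_of_lt hlt) ν hreach

end Terminal

end LocalGameEFTDimTwoGame

end Summit.ResolutionOfSingularities.ResolutionOfSingularities.Theorems

end
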